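import Mathlib
import HarnessLib
import Literature.AlgebraicGeometry.HyperbolicPolynomials.SpectrahedralShadow
import Literature.AlgebraicGeometry.HyperbolicPolynomials.SpectrahedralShadowCalculus
import Summits.ValiantsHypothesis.ValiantsHypothesis.Theorems.PermanentalConesHyperbolicVPShadowBlockCases

/-!
# ValiantsHypothesis / PermanentalCones — `HyperbolicVPShadow`, stub `stub_cone_of_conjPreimage`

Route `PermanentalCones`, item `stmt-ValiantsHypothesis-8655` (crux `HyperbolicVPShadow`), line
`birth`, stub `stub_cone_of_conjPreimage`: the bookkeeping step behind the use of Oshime's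
classification (T. Oshime, 1991) of real-spectrum `3 × 3` linear pencils. Every relevant pencil
`P : ℝⁿ →ₗ Mat_N(ℝ)` is *equivalent* to one of finitely many canonical pencils `G : ℝⁿ' →ₗ Mat_N(ℝ)`:
`P x = T · G (M x) · T⁻¹` or `P x = T · (G (M x))ᵀ · T⁻¹` for an invertible `T` and a linear
reparametrisation `M : ℝⁿ →ₗ ℝⁿ'`. Since similarity and transposition do not change
`det (· + τ·1)`, the closed nonnegative-spectrum cone of `P` is the linear preimage under `M` of
the cone of `G`:

  `{x : ∀ τ > 0, det (P x + τ·1) ≠ 0} = M ⁻¹' {y : ∀ τ > 0, det (G y + τ·1) ≠ 0}`,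

and a lifted-LMI description `{y : ∃ w, A (y, w) + B ⪰ 0}` of size `m` of the cone of `G` pulls
back to the description `{x : ∃ w, A (M x, w) + B ⪰ 0}` of the cone of `P`; padding with an
identity block of size `k` (`fromBlocks (A (M x, w) + B) 0 0 1 ⪰ 0 ↔ A (M x, w) + B ⪰ 0`) gives a
description of any size `m' = m + k ≥ m`.

## Contents

* `permanentalCones_conjPreimage_nonnegSpectrum_transpose_iff` — `det (Xᵀ + τ·1) ≠ 0 ∀ τ > 0`
  iff the same for `X`;
* `permanentalCones_conjPreimage_mem_iff` — the set identity above, pointwise;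
* `permanentalCones_conjPreimage_isSpectrahedralShadowOfSize_preimage_pad` — linear preimage and
  size padding of a sized lifted-LMI description;
* `stub_cone_of_conjPreimage` — the registered stub.

All statements are folklore linear algebra; no named facts.
-/

-- `<Problem> = <Summit>` for this single-conjunct summit (lakefile sets the same option tree-wide).
set_option linter.dupNamespace false

noncomputable section

namespace Summit.ValiantsHypothesis.ValiantsHypothesis.Theorems

open Matrix
open Literature.AlgebraicGeometry.HyperbolicPolynomials

/-! ### Transposition invariance of the cone condition -/

/-- The closed "no negative eigenvalue" condition `∀ τ > 0, det (X + τ·1) ≠ 0` is invariant under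
transposition (`(X + τ·1)ᵀ = Xᵀ + τ·1` and `det Yᵀ = det Y`). [folklore] -/
theorem permanentalCones_conjPreimage_nonnegSpectrum_transpose_iff {ι : Type*} [Fintype ι]
    [DecidableEq ι] (X : Matrix ι ι ℝ) :
    (∀ τ : ℝ, 0 < τ → (X.transpose + τ • (1 : Matrix ι ι ℝ)).det ≠ 0) ↔
      ∀ τ : ℝ, 0 < τ → (X + τ • (1 : Matrix ι ι ℝ)).det ≠ 0 := by
  refine forall_congr' fun τ => imp_congr_right fun _ => ?_
  rw [show X.transpose + τ • (1 : Matrix ι ι ℝ) = (X + τ • (1 : Matrix ι ι ℝ)).transpose by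
    rw [Matrix.transpose_add, Matrix.transpose_smul, Matrix.transpose_one], Matrix.det_transpose]

/-! ### The cone of an equivalent pencil is a linear preimage -/

/-- If `P x = T · G (M x) · T⁻¹` for all `x`, or `P x = T · (G (M x))ᵀ · T⁻¹` for all `x`, with `T`
invertible, then `P x` has no negative eigenvalue iff `G (M x)` has none: the closed
nonnegative-spectrum cone of `P` is the preimage under `M` of that of `G`. [folklore] -/
theorem permanentalCones_conjPreimage_mem_iff (n n' N : ℕ)
    (P : (Fin n → ℝ) →ₗ[ℝ] Matrix (Fin N) (Fin N) ℝ)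
    (G : (Fin n' → ℝ) →ₗ[ℝ] Matrix (Fin N) (Fin N) ℝ) (M : (Fin n → ℝ) →ₗ[ℝ] (Fin n' → ℝ))
    (T : Matrix (Fin N) (Fin N) ℝ) (hT : IsUnit T)
    (hPG : (∀ x, P x = T * G (M x) * T⁻¹) ∨ (∀ x, P x = T * (G (M x)).transpose * T⁻¹))
    (x : Fin n → ℝ) :
    (∀ τ : ℝ, 0 < τ → (P x + τ • (1 : Matrix (Fin N) (Fin N) ℝ)).det ≠ 0) ↔
      ∀ τ : ℝ, 0 < τ → (G (M x) + τ • (1 : Matrix (Fin N) (Fin N) ℝ)).det ≠ 0 := by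
  rcases hPG with hPG | hPG
  · rw [hPG x, permanentalCones_nonnegSpectrum_conj_iff hT]
  · rw [hPG x, permanentalCones_nonnegSpectrum_conj_iff hT,
      permanentalCones_conjPreimage_nonnegSpectrum_transpose_iff]

/-! ### Linear preimages and size padding of sized lifted-LMI descriptions -/

/-- **Linear preimage with padding.** If `K ⊆ ℝ^σ'` has a lifted-LMI description of size `m` and
`M : ℝ^σ →ₗ ℝ^σ'` is linear, then `M ⁻¹' K` has one of size `m + k` for every `k`: pull the pencil
back along `M` and add an identity diagonal block of size `k` (block-diagonal LMI
`fromBlocks (A (M x, w) + B) 0 0 1`). [folklore] -/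
theorem permanentalCones_conjPreimage_isSpectrahedralShadowOfSize_preimage_pad {σ σ' : Type*}
    {K : Set (σ' → ℝ)} {m : ℕ} (hK : IsSpectrahedralShadowOfSize K m)
    (M : (σ → ℝ) →ₗ[ℝ] (σ' → ℝ)) (k : ℕ) :
    IsSpectrahedralShadowOfSize (M ⁻¹' K) (m + k) := by
  obtain ⟨p, A, B, h⟩ := hK
  have hrep := permanentalCones_isSpectrahedralShadowOfSize_of_rep (K := M ⁻¹' K)
    (blockDiagLin (A ∘ₗ M.prodMap (LinearMap.id : (Fin p → ℝ) →ₗ[ℝ] (Fin p → ℝ)))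
      (0 : ((σ → ℝ) × (Fin p → ℝ)) →ₗ[ℝ] Matrix (Fin k) (Fin k) ℝ))
    (fromBlocks B 0 0 1) (fun x => by
      simp only [Set.mem_preimage, h, blockDiagLin_apply, LinearMap.comp_apply,
        LinearMap.prodMap_apply, LinearMap.id_apply, LinearMap.zero_apply, fromBlocks_add,
        add_zero, zero_add, posSemidef_fromBlocks_zero_iff, Matrix.PosSemidef.one, and_true])
  simpa only [Fintype.card_sum, Fintype.card_fin] using hrep

/-! ### The registered stub -/

/-- **Cones of equivalent pencils** (bookkeeping for Oshime's 1991 classification of real-spectrum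
pencils). If the linear pencil `P : ℝⁿ →ₗ Mat_N(ℝ)` is equivalent to the pencil `G : ℝⁿ' →ₗ Mat_N(ℝ)`
— `P x = T · G (M x) · T⁻¹` for all `x`, or `P x = T · (G (M x))ᵀ · T⁻¹` for all `x`, with `T`
invertible and `M` linear — and the closed nonnegative-spectrum cone
`{y : ∀ τ > 0, det (G y + τ·1) ≠ 0}` of `G` is a lifted-LMI set of size `m`, then the cone
`{x : ∀ τ > 0, det (P x + τ·1) ≠ 0}` of `P` is a lifted-LMI set of every size `m' ≥ m`
(it is the preimage of the former under `M`; pad with an identity block). [folklore] -/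
theorem stub_cone_of_conjPreimage :
    ∀ (n n' N m m' : ℕ) (P : (Fin n → ℝ) →ₗ[ℝ] Matrix (Fin N) (Fin N) ℝ)
      (G : (Fin n' → ℝ) →ₗ[ℝ] Matrix (Fin N) (Fin N) ℝ) (M : (Fin n → ℝ) →ₗ[ℝ] (Fin n' → ℝ))
      (T : Matrix (Fin N) (Fin N) ℝ), IsUnit T →
      ((∀ x, P x = T * G (M x) * T⁻¹) ∨ (∀ x, P x = T * (G (M x)).transpose * T⁻¹)) → m ≤ m' →
      Literature.AlgebraicGeometry.HyperbolicPolynomials.IsSpectrahedralShadowOfSize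
        {y : Fin n' → ℝ | ∀ τ : ℝ, 0 < τ → (G y + τ • (1 : Matrix (Fin N) (Fin N) ℝ)).det ≠ 0} m →
      Literature.AlgebraicGeometry.HyperbolicPolynomials.IsSpectrahedralShadowOfSize
        {x : Fin n → ℝ | ∀ τ : ℝ, 0 < τ → (P x + τ • (1 : Matrix (Fin N) (Fin N) ℝ)).det ≠ 0} m' := by
  intro n n' N m m' P G M T hT hPG hmm' hG
  -- the cone of `P` is the preimage under `M` of the cone of `G`
  have hset :
      {x : Fin n → ℝ | ∀ τ : ℝ, 0 < τ → (P x + τ • (1 : Matrix (Fin N) (Fin N) ℝ)).det ≠ 0} =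
        M ⁻¹' {y : Fin n' → ℝ | ∀ τ : ℝ, 0 < τ →
          (G y + τ • (1 : Matrix (Fin N) (Fin N) ℝ)).det ≠ 0} := by
    ext x
    simp only [Set.mem_setOf_eq, Set.mem_preimage]
    exact permanentalCones_conjPreimage_mem_iff n n' N P G M T hT hPG x
  -- `m' = m + k`: pull back and pad
  obtain ⟨k, rfl⟩ : ∃ k, m' = m + k := ⟨m' - m, by omega⟩
  rw [hset]
  exact permanentalCones_conjPreimage_isSpectrahedralShadowOfSize_preimage_pad hG M k

end Summit.ValiantsHypothesis.ValiantsHypothesis.Theorems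

end
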